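import Summits.QuantumFields.YangMills.Theorems.BalabanUVNodesN12NearFlatChartLetter
import Summits.QuantumFields.YangMills.Theorems.BalabanUVNodesN12NearFlatDelta2LetterEta

/-!
# DAG node N12 [B15] — THE CHART LETTER (χ) IN PRINT's η-UNITS: the sup-norm CORE edition of `…N12NearFlatChartLetter.chartLetter_of_letters` (file 2, p630404) and, as its corollary, the
# η-pinned letter `(χ)_η` of dag-n12-w5's `B15Prop1NearFlatPackageFromLetters.nearFlatPackage_of_letters_eta` (p629636 §4: `q := q_η`, `q_η(v) = √(Σ_i ((L^d)∕(L²))^{j_i}·‖v i‖²)` —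
# dag-n12-c g18's LANE WORD LOCATED-RHO exit (b)), the (δ₂) row fed by dag-n10-w1's item (iii) `…N12NearFlatDelta2LetterEta` BY NAME

[Balaban1989LargeFieldII] = «[LF-II]», p. 357, (1.12)–(1.13) p. 359, (17)–(19) pp. 360–361 (level-weighted norms); [Balaban1985Variational] = «[15]», Sect. C (44)–(48) p. 285, (81)–(83)
p. 290; [Balaban1988Convergent] = «[III]», (2.2) p. 255, (2.10)–(2.13) pp. 256–257; [Balaban1985Averaging], (17)–(19) pp. 20–21.

Cell `pub-ymgap`, HUMAN RULINGS D-0062 ∕ D-0149, width seat `pub-ymgap-dag-n12-w4` g4 (INBOX CLAIM-2 of 2026-08-28).  `--kind proof --supports stmt-QuantumFields-27364 --as helper` (K1⁹);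
count-neutral.  NEW leaf; CONSUMED BY NAME, nothing modified: files 1–2 of this seat (p629850 ∕ p630404) and their producers; dag-n10-w1's `…N12EtaSizeDefs` (`qEta`, `levelWeight`,
`qEta_def`, `levelWeight_eq_pow`, `levelWeight_mul_norm_sq_le_qEta_sq`) and `…N12NearFlatDelta2LetterEta.qEta_le_sqrt_sum_mul_norm`.
WHY ∕ HOW.  File 2 binds `q` existentially (its proof takes the sup norm).  §1 re-states the assembled letter with `q` SPELLED `‖·‖` (same composition); §2 derives `(χ)_η` by two
exchanges: `‖v‖ ≤ q_η(v)` (§0: every level weight `L^{(d−2)j} ≥ 1` at `d ≥ 2`) for the right-inverse row and `q_η(w) ≤ √(Σ_i ((L^d)∕(L²))^{j_i})·‖w‖` ((iii) §1) for the (δ₂) row,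
the latter's per-instance factor absorbed into `C₂`.
CONTENTS (namespace `Summit.QuantumFields.YangMills.BalabanUVNodes.N12NearFlatChartLetter`; theorems only — no `def`, no `instance`, no `sorry`).  §0 `norm_le_qEta`; §1 ★★
`chartLetter_of_letters_supNorm`; §2 ★★★ `chartLetter_of_letters_eta` — `(χ)_η` VERBATIM (five ∃-witnesses `Ψ₂ λ p L_f R_f`), constants `∃ ρs Cμ Cρ C₂ Cτ` as in file 2.
HONEST FRAMING ∕ LOCATED.  A CURRENCY RE-SPELLING with the SAME per-height ∕ instance existence constants: `ρc` is still dag-n10-w1's sup-op letter of the flat right inverse, so it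
still carries the LOCATED-RHO floor (no `O(1)` UPPER letter in η-units is claimed — [15] (44)–(46)'s class, dag-n10-w1's item (i-c), open); (δ₂) in η-units is the sup letter through the
row-weight exchange (no `ℓ²`-gain claimed).  Nothing of Bałaban's asserted; count-neutral; N12 NOT discharged; K1⁹ NOT closed; counts unmoved (5∕27); one finite 𝕋⁴ programme at fixed
ε — R4 closes the conditional finite-𝕋⁴ rung `BalabanLadder.UV` only; NOT continuum ∕ ℝ⁴ ∕ OS ∕ mass gap ∕ Clay.
-/


noncomputable section

open scoped BigOperators Matrix.Norms.L2Operator Topology NNReal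
open Filter Finset Metric

namespace Summit.QuantumFields.YangMills.BalabanUVNodes.N12NearFlatChartLetter

open Literature.MathematicalPhysics.QuantumFieldTheory.Balaban1983to89
open Literature.MathematicalPhysics.QuantumLattice (quatMatrix)
open T4Continuum (T4Family)
open T4HaarSU2ExpChart (imQuat)
open T4AdjointCovarianceUnitary (lieSU)
open T4CubeChartGnomonic (SU2)
open B15DeterminingSets GaugeField
open B14.Eq213DetSet (Bj Bj_of_gt Bj_zero maxDomT)
open B14.Eq213MaximalDomains (side)
open B14.Eq216Concrete (inputs mem_inputs feeds_zero)
open B15Prop1SliceCoordinates (GaugeSlice ιA)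
open B15Prop1ChartCalculusSU2 (E3)
open B15Prop1ChartSU2 (su2Chart)
open B16Sect1Backgrounds (expMul)
open T4AxialGaugeSmallField (castSite)
open B6TreeGaugePoincare (curl)
open B16Eq18Proof (box)
open BlockAveragingEMLLinearised (linAvg)
open ExpMeanLog (expMeanLogSU deltaSU)
open Literature.MathematicalPhysics.QuantumFieldTheory.BalabanImbrieJaffe1984to88.BIJ85Eq453GaugeField (qsstarGIter0)
open Node00
open Summit.QuantumFields.YangMills.Theorems.BlockAvgCorrector (stokesConst)
open B16Ineq19FlatSliceChart (exists_lieSU2Coord)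
open B16Ineq19NearFlatSliceNorms (opNorm_coe_le_norm_lieSU sum_opNorm_coe_sq_le_sum_norm_sq)
open B16Ineq17NearFlatWilsonLettersLocal (letter_j_wilson_local)
open Summit.QuantumFields.YangMills.BalabanUVNodes.N12NearFlatFederbushFibreTwisted (exists_m_hm_twisted_window_of_isMinimizer_family)
open Summit.QuantumFields.YangMills.BalabanUVNodes.N12NearFlatDelta2Letter (exists_delta2_letter_Bj exists_guard_of_nearFlat exists_rightInverse_fun_of_flat_of_delta2)
open Summit.QuantumFields.YangMills.BalabanUVNodes.N12GuardedLinAvgRightInverseBj (exists_rightInverse_fderiv_msChart_Bj_one)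
open Summit.QuantumFields.YangMills.BalabanUVNodes.N12GuardedChartDerivIterLin (exists_norm_iterM_sub_one_le)
open Summit.QuantumFields.YangMills.BalabanUVNodes.N12FlatRightInverseLetterFloor (norm_sq_lieSU_le_card_mul_opNorm_sq)
open Summit.QuantumFields.YangMills.BalabanUVNodes.N12EtaSizeDefs (qEta levelWeight qEta_def qEta_nonneg levelWeight_eq_pow levelWeight_mul_norm_sq_le_qEta_sq)
open Summit.QuantumFields.YangMills.BalabanUVNodes.N12NearFlatDelta2LetterEta (qEta_le_sqrt_sum_mul_norm)

variable {F : T4Family}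

/-! ## §3  ★★★ The chart letter (χ), assembled -/


/-! ## §0  Sup norm versus print's η-unit size on the enumerated rows -/

section EtaVsSup

variable {P : Params} {N : ℕ}

/-- `‖v‖ ≤ q_η(v)` at `d ≥ 2`: every level weight `((L^d)∕(L²))^j = L^{(d−2)j}` is `≥ 1`, so each row's `𝔰𝔲(N)`-norm is at most `qEta`, hence so is the sup norm.
[cite: Balaban1989LargeFieldII, (17)–(19) pp.360–361 (bookkeeping)] -/
theorem norm_le_qEta (hd : 2 ≤ P.d) (𝔹 : DetSet P) (k : ℕ) (v : Fin (constrCard 𝔹 k) → lieSU (Fin N)) : ‖v‖ ≤ qEta 𝔹 k v := by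
  refine (pi_norm_le_iff_of_nonneg (qEta_nonneg 𝔹 k v)).2 fun i => ?_
  have hL : (1 : ℝ) ≤ (P.L : ℝ) := by exact_mod_cast P.L_pos
  have hw : 1 ≤ levelWeight P (((constrEnum 𝔹 k).symm i).1 : ℕ) := by
    rw [levelWeight_eq_pow hd]
    exact one_le_pow₀ hL
  have hsq : ‖v i‖ ^ 2 ≤ qEta 𝔹 k v ^ 2 :=
    calc ‖v i‖ ^ 2 = 1 * ‖v i‖ ^ 2 := (one_mul _).symm
      _ ≤ levelWeight P (((constrEnum 𝔹 k).symm i).1 : ℕ) * ‖v i‖ ^ 2 := mul_le_mul_of_nonneg_right hw (sq_nonneg _)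
      _ ≤ qEta 𝔹 k v ^ 2 := levelWeight_mul_norm_sq_le_qEta_sq 𝔹 k v i
  exact (pow_le_pow_iff_left₀ (norm_nonneg _) (qEta_nonneg 𝔹 k v) two_ne_zero).1 hsq

end EtaVsSup

/-! ## §1  The core edition: `q` spelled as the sup norm -/

section Main

set_option maxHeartbeats 400000 in
/-- ★★ **THE CHART LETTER (χ) WITH ITS SIZE `q` SPELLED AS THE SUP NORM** — the CORE edition of `…N12NearFlatChartLetter.chartLetter_of_letters` (file 2, p630404): the same hypotheses,
constants and composition by name, with the ∃-bound size `q` replaced by `‖·‖` in the two conjuncts that mention it (`p(R_f v) ≤ Cρ‖v‖`, `‖DΨ(0)(X_f′X) − L_f(X_f′X)‖ ≤ C₂·max δc δin·p`),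
so that every other currency for `q` is a corollary (§2).  See file 2's docstring for the proof map and the typing note (`maxHeartbeats 400000`: cumulative unification only).
[cite: Balaban1989LargeFieldII, p.357, (1.7)–(1.9) p.358, (1.12)–(1.13) p.359; Balaban1985Variational, Sect. C (44)–(48) p.285, (81)–(83) p.290, (172) p.305; Balaban1988Convergent, (2.2) p.255, (2.10)–(2.13) pp.256–257; Balaban1985Averaging, Prop. 3 (121)–(125) p.36] -/
theorem chartLetter_of_letters_supNorm (ν : Node00.Stage7Numerics) (Kt : ℕ) (h0 : 0 < (F.P Kt).d) (h2 : 2 ≤ (F.P Kt).d)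
    {k : ℕ} (hk0 : 0 < k) (hk : k ≤ (F.P Kt).m + (F.P Kt).K)
    (Z Λ : Set (Site (F.P Kt) 0)) (T : Finset (PBond (F.P Kt) k)) (lo hi : Fin (F.P Kt).d → ℤ)
    -- instance geometry letters (displayed)
    (hM2 : 2 ≤ ν.M₁) (hdiv : side (F.P Kt).L ν.M₁ k ∣ (F.P Kt).sitesPerDir 0)
    (hbox : ∀ κ, (((hi κ - lo κ + 1).toNat + 3 : ℕ) : ℤ) ≤ (F.P Kt).sitesPerDir k)
    (hΩw : ∀ (ν' : Fin (F.P Kt).d), ∀ z ∈ box (fun κ => (hi κ - lo κ + 1).toNat + 3) (fun κ => lo κ - 2),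
      (castSite z : Site (F.P Kt) k) ∈ pts k (maxDomT ν.M₁ Z k) ∧ (castSite z : Site (F.P Kt) k).shift ⟨0, h0⟩ ∈ pts k (maxDomT ν.M₁ Z k) ∧
        (castSite z : Site (F.P Kt) k).shift ν' ∈ pts k (maxDomT ν.M₁ Z k)) :
    ∃ ρs Cμ Cρ C₂ Cτ : ℝ, 0 < ρs ∧ 0 ≤ Cμ ∧ 0 ≤ Cρ ∧ 0 ≤ C₂ ∧ 0 ≤ Cτ ∧
      ∀ (ext : GaugeField (F.P Kt) k SU2 → GaugeField (F.P Kt) k SU2) (Vk : GaugeField (F.P Kt) k SU2) {R 𝓐₀ : ℝ}, 0 < R → 0 ≤ 𝓐₀ →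
      ∀ {δc δin : ℝ}, 0 ≤ δc → 0 ≤ δin → 0 < max δc δin → max δc δin ≤ ρs →
      ∀ (U₀ : GaugeField (F.P Kt) 0 SU2) (Xf : GaugeSlice (pts k Λ) T E3 → PBond (F.P Kt) 0 → lieSU (Fin 2)),
      IsMinimizer (Node00.avOfRecord F 2 Kt) (Node00.regMSCoPOfRecord F 2 ν Kt k (maxDomT ν.M₁ Z)) (Bj ν.M₁ Z k)
        (avgFamily (Node00.avOfRecord F 2 Kt) (qsstarGIter0 k (ext Vk))) U₀ →
      (∀ p : Plaq (F.P Kt) 0, ((⟨p.src, p.μ⟩ : PBond (F.P Kt) 0) ∈ {b : PBond (F.P Kt) 0 | b.src ∈ maxDomT ν.M₁ Z 1} ∨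
          (⟨p.src.shift p.μ, p.ν⟩ : PBond (F.P Kt) 0) ∈ {b : PBond (F.P Kt) 0 | b.src ∈ maxDomT ν.M₁ Z 1} ∨
          (⟨p.src.shift p.ν, p.μ⟩ : PBond (F.P Kt) 0) ∈ {b : PBond (F.P Kt) 0 | b.src ∈ maxDomT ν.M₁ Z 1} ∨
          (⟨p.src, p.ν⟩ : PBond (F.P Kt) 0) ∈ {b : PBond (F.P Kt) 0 | b.src ∈ maxDomT ν.M₁ Z 1}) →
        ‖((U₀ ⟨p.src, p.μ⟩ : SU2) : Matrix (Fin 2) (Fin 2) ℂ) - 1‖ ≤ δc ∧ ‖((U₀ ⟨p.src.shift p.μ, p.ν⟩ : SU2) : Matrix (Fin 2) (Fin 2) ℂ) - 1‖ ≤ δc ∧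
          ‖((U₀ ⟨p.src.shift p.ν, p.μ⟩ : SU2) : Matrix (Fin 2) (Fin 2) ℂ) - 1‖ ≤ δc ∧ ‖((U₀ ⟨p.src, p.ν⟩ : SU2) : Matrix (Fin 2) (Fin 2) ℂ) - 1‖ ≤ δc) →
      (∀ b ∈ inputs (Bj ν.M₁ Z k), ‖((U₀ b : SU2) : Matrix (Fin 2) (Fin 2) ℂ) - 1‖ ≤ δin) →
      Xf 0 = 0 → ContDiffAt ℝ 2 Xf 0 →
      (∀ᶠ Y in 𝓝 (0 : GaugeSlice (pts k Λ) T E3),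
        IsMinimizer (Node00.avOfRecord F 2 Kt) (Node00.regMSCoPOfRecord F 2 ν Kt k (maxDomT ν.M₁ Z)) (Bj ν.M₁ Z k)
          (avgFamily (Node00.avOfRecord F 2 Kt) (qsstarGIter0 k (expMul su2Chart (ιA (pts k Λ) T Y) (ext Vk)))) (expChart U₀ (Xf Y))) →
      (∀ (X : GaugeSlice (pts k Λ) T E3) (b : PBond (F.P Kt) 0),
        ‖((fderiv ℝ Xf 0 X b : lieSU (Fin 2)) : Matrix (Fin 2) (Fin 2) ℂ)‖ ≤ 8 * 𝓐₀ / R * ‖X‖ ∧ ‖fderiv ℝ Xf 0 X b‖ ≤ 12 * 𝓐₀ / R * ‖X‖) →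
      (∀ (X : GaugeSlice (pts k Λ) T E3) (b : PBond (F.P Kt) 0), b.src ∉ maxDomT ν.M₁ Z 1 → fderiv ℝ Xf 0 X b = 0) →
      ∃ (Ψ₂ : (PBond (F.P Kt) 0 → lieSU (Fin 2)) →L[ℝ] (PBond (F.P Kt) 0 → lieSU (Fin 2)) →L[ℝ] (Fin (constrCard (Bj ν.M₁ Z k) k) → lieSU (Fin 2)))
        (lam : (Fin (constrCard (Bj ν.M₁ Z k) k) → lieSU (Fin 2)) →L[ℝ] ℝ)
        (p : Seminorm ℝ (PBond (F.P Kt) 0 → lieSU (Fin 2)))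
        (Lf : (PBond (F.P Kt) 0 → lieSU (Fin 2)) →L[ℝ] (Fin (constrCard (Bj ν.M₁ Z k) k) → lieSU (Fin 2)))
        (Rf : (Fin (constrCard (Bj ν.M₁ Z k) k) → lieSU (Fin 2)) → PBond (F.P Kt) 0 → lieSU (Fin 2)),
        HasFDerivAt (fun Y => fderiv ℝ (msChart F 2 Kt k (Bj ν.M₁ Z k) (avgFamily (Node00.avOfRecord F 2 Kt) (qsstarGIter0 k (ext Vk))) U₀) Y) Ψ₂ 0 ∧
        (∀ᶠ Y in 𝓝 (0 : PBond (F.P Kt) 0 → lieSU (Fin 2)),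
          DifferentiableAt ℝ (msChart F 2 Kt k (Bj ν.M₁ Z k) (avgFamily (Node00.avOfRecord F 2 Kt) (qsstarGIter0 k (ext Vk))) U₀) Y) ∧
        fderiv ℝ (fun Y : PBond (F.P Kt) 0 → lieSU (Fin 2) => wilsonAction4 (expChart U₀ Y)) 0 =
          lam.comp (fderiv ℝ (msChart F 2 Kt k (Bj ν.M₁ Z k) (avgFamily (Node00.avOfRecord F 2 Kt) (qsstarGIter0 k (ext Vk))) U₀) 0) ∧
        (∀ Y : PBond (F.P Kt) 0 → lieSU (Fin 2), ∑ b, ‖(Y b : Matrix (Fin 2) (Fin 2) ℂ)‖ ^ 2 ≤ p Y ^ 2) ∧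
        (∀ v, Lf (Rf v) = v) ∧ (∀ v, p (Rf v) ≤ Cρ * ‖v‖) ∧
        ∀ X : GaugeSlice (pts k Λ) T E3,
          ‖fderiv ℝ (msChart F 2 Kt k (Bj ν.M₁ Z k) (avgFamily (Node00.avOfRecord F 2 Kt) (qsstarGIter0 k (ext Vk))) U₀) 0 (fderiv ℝ Xf 0 X)
              - Lf (fderiv ℝ Xf 0 X)‖ ≤ (C₂ * max δc δin) * p (fderiv ℝ Xf 0 X) ∧
          lam (Ψ₂ (fderiv ℝ Xf 0 X) (fderiv ℝ Xf 0 X)) ≤ (Cμ * max δc δin) * p (fderiv ℝ Xf 0 X) ^ 2 ∧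
          p (fderiv ℝ Xf 0 X) ≤ (12 * 𝓐₀ / R * Real.sqrt (Nat.card {b : PBond (F.P Kt) 0 // b.src ∈ maxDomT ν.M₁ Z 1})) * ‖X‖ ∧
          ∃ m : ℝ, (∀ w', Lf w' = fderiv ℝ (msChart F 2 Kt k (Bj ν.M₁ Z k) (avgFamily (Node00.avOfRecord F 2 Kt) (qsstarGIter0 k (ext Vk))) U₀) 0
                (fderiv ℝ Xf 0 X) →
              m ≤ fderiv ℝ (fun Y => fderiv ℝ (fun Y : PBond (F.P Kt) 0 → lieSU (Fin 2) => wilsonAction4 (expChart (1 : GaugeField (F.P Kt) 0 SU2) Y)) Y) 0 w' w') ∧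
            (((F.P Kt).L : ℝ) ^ (F.P Kt).d) ^ k / ((((F.P Kt).L : ℝ)) ^ 2 * ((F.P Kt).L : ℝ) ^ 2) ^ k *
                (∑ z ∈ box (fun κ => (hi κ - lo κ + 1).toNat + 3) (fun κ => lo κ - 2), ∑ μ : Fin (F.P Kt).d, ∑ a : Fin 3,
                  curl (fun b => ιA (pts k Λ) T X (⟨castSite b.1, b.2⟩ : PBond (F.P Kt) k) a) z ⟨0, h0⟩ μ ^ 2)
              - ((((F.P Kt).L : ℝ) ^ (F.P Kt).d) ^ k / ((((F.P Kt).L : ℝ)) ^ 2 * ((F.P Kt).L : ℝ) ^ 2) ^ k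
                  * (16 * (((F.P Kt).d : ℝ) + 1) * (Cτ * max δc δin))) * ‖X‖ ^ 2 ≤ m := by
  let Q : (i : ℕ) → (PBond (F.P Kt) 0 → Matrix (Fin 2) (Fin 2) ℂ) → PBond (F.P Kt) i → Matrix (Fin 2) (Fin 2) ℂ := fun i =>
    Nat.rec (motive := fun i => (PBond (F.P Kt) 0 → Matrix (Fin 2) (Fin 2) ℂ) → PBond (F.P Kt) i → Matrix (Fin 2) (Fin 2) ℂ)
      (fun Y => Y) (fun _ q Y c => linAvg (q Y) c) i
  have hQ0 : ∀ Y, Q 0 Y = Y := fun Y => rfl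
  have hQs : ∀ (i : ℕ) (Y : PBond (F.P Kt) 0 → Matrix (Fin 2) (Fin 2) ℂ) (c : PBond (F.P Kt) (i + 1)), Q (i + 1) Y c = linAvg (Q i Y) c :=
    fun i Y c => rfl
  let p : Seminorm ℝ (PBond (F.P Kt) 0 → lieSU (Fin 2)) :=
    (normSeminorm ℝ (PiLp 2 (fun _ : PBond (F.P Kt) 0 => lieSU (Fin 2)))).comp (WithLp.linearEquiv 2 ℝ (PBond (F.P Kt) 0 → lieSU (Fin 2))).symm.toLinearMap
  have hp : ∀ Y : PBond (F.P Kt) 0 → lieSU (Fin 2), ∑ b, ‖(Y b : Matrix (Fin 2) (Fin 2) ℂ)‖ ^ 2 ≤ p Y ^ 2 := fun Y => sum_opNorm_sq_le_l2Seminorm_sq Y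
  let n : ℝ := Real.sqrt (Fintype.card (PBond (F.P Kt) 0))
  have hn0 : 0 ≤ n := Real.sqrt_nonneg _
  have hpsup : ∀ Y : PBond (F.P Kt) 0 → lieSU (Fin 2), p Y ≤ n * ‖Y‖ := fun Y => l2Seminorm_le_sqrt_card_mul_norm Y
  have hpl1 : ∀ Y : PBond (F.P Kt) 0 → lieSU (Fin 2), ∑ b, ‖(Y b : Matrix (Fin 2) (Fin 2) ℂ)‖ ≤ n * p Y := fun Y => sum_opNorm_le_sqrt_card_mul_l2Seminorm Y
  let p₁ : Seminorm ℝ (PBond (F.P Kt) 0 → lieSU (Fin 2)) :=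
    p.comp (n • (LinearMap.id : (PBond (F.P Kt) 0 → lieSU (Fin 2)) →ₗ[ℝ] (PBond (F.P Kt) 0 → lieSU (Fin 2))))
  have hp₁_apply : ∀ Y : PBond (F.P Kt) 0 → lieSU (Fin 2), p₁ Y = n * p Y := fun Y => by
    show p ((n • (LinearMap.id : (PBond (F.P Kt) 0 → lieSU (Fin 2)) →ₗ[ℝ] (PBond (F.P Kt) 0 → lieSU (Fin 2)))) Y) = n * p Y
    rw [LinearMap.smul_apply, LinearMap.id_apply, map_smul_eq_mul, Real.norm_of_nonneg hn0]
  have hp₁ : ∀ Y : PBond (F.P Kt) 0 → lieSU (Fin 2), ∑ b, ‖(Y b : Matrix (Fin 2) (Fin 2) ℂ)‖ ≤ p₁ Y := fun Y => by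
    rw [hp₁_apply]; exact hpl1 Y
  obtain ⟨C, ρD, hC, hρD, hD⟩ := exists_delta2_letter_Bj (F := F) (N := 2) (K := Kt) k ν.M₁ Z Q hQ0 hQs p hp
  obtain ⟨t₀, ρg, ht₀, hst, hρg, hguard⟩ := exists_guard_of_nearFlat (F := F) (N := 2) Kt k
  obtain ⟨M₂, ρμ, hM₂, hρμ, hμ⟩ := exists_uniform_lam_mu_msChart (F := F) (N := 2) (K := Kt) k p hp
  obtain ⟨M₂', ρb, -, hρb, hsbU, -⟩ := exists_uniform_chartCurvature_sq_bound (F := F) (N := 2) (K := Kt) k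
  obtain ⟨Hf, B, hB0, hHf, hHfB⟩ := exists_rightInverse_fderiv_msChart_Bj_one (F := F) (N := 2) (K := Kt) (k := k) hM2 hk (Z := Z) hdiv
  let ρf : ℝ := n * Real.sqrt 2 * B
  have hρf0 : 0 ≤ ρf := by positivity
  have hρf : ∀ v, p (Hf v) ≤ ρf * ‖v‖ := fun v => by
    have hterm : ∀ b, ‖Hf v b‖ ^ 2 ≤ 2 * (B * ‖v‖) ^ 2 := fun b => by
      have h1 := norm_sq_lieSU_le_card_mul_opNorm_sq (Hf v b)
      have h2 : ‖((Hf v b : lieSU (Fin 2)) : Matrix (Fin 2) (Fin 2) ℂ)‖ ≤ B * ‖v‖ :=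
        (norm_le_pi_norm (fun b => ((Hf v b : lieSU (Fin 2)) : Matrix (Fin 2) (Fin 2) ℂ)) b).trans (hHfB v)
      have h3 := pow_le_pow_left₀ (norm_nonneg _) h2 2
      calc ‖Hf v b‖ ^ 2 ≤ ((2 : ℕ) : ℝ) * ‖((Hf v b : lieSU (Fin 2)) : Matrix (Fin 2) (Fin 2) ℂ)‖ ^ 2 := h1
        _ ≤ 2 * (B * ‖v‖) ^ 2 := by rw [Nat.cast_ofNat]; exact mul_le_mul_of_nonneg_left h3 (by norm_num)
    have e : p (Hf v) = Real.sqrt (∑ b, ‖Hf v b‖ ^ 2) := l2Seminorm_apply _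
    rw [e]
    calc Real.sqrt (∑ b, ‖Hf v b‖ ^ 2) ≤ Real.sqrt (∑ _b : PBond (F.P Kt) 0, 2 * (B * ‖v‖) ^ 2) :=
          Real.sqrt_le_sqrt (Finset.sum_le_sum fun b _ => hterm b)
      _ = Real.sqrt ((Fintype.card (PBond (F.P Kt) 0) : ℝ) * (Real.sqrt 2 * (B * ‖v‖)) ^ 2) := by
          congr 1
          rw [Finset.sum_const, Finset.card_univ, nsmul_eq_mul, mul_pow (Real.sqrt 2) (B * ‖v‖) 2,
            Real.sq_sqrt (by norm_num : (0 : ℝ) ≤ 2)]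
      _ = n * (Real.sqrt 2 * (B * ‖v‖)) := by rw [Real.sqrt_mul (Nat.cast_nonneg _), Real.sqrt_sq (by positivity)]
      _ = ρf * ‖v‖ := by simp only [ρf]; ring
  obtain ⟨Kτ, ρτ, hKτ, hρτ, hτW⟩ := exists_norm_iterM_sub_one_le (P := F.P Kt) (N := 2) k
  refine ⟨min (min (ρD / 2) ρg) (min (min ρμ ρb) (min (ρτ / 2) (1 / (2 * (C * ρf + 1))))),
    32 * (((F.P Kt).d : ℝ) - 1) * n * ρf * M₂, ρf, C, 2 * (Kτ + 1),
    by positivity, ?_, hρf0, hC, by positivity, ?_⟩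
  · have hd1 : (1 : ℝ) ≤ ((F.P Kt).d : ℝ) := by exact_mod_cast h0
    have : 0 ≤ ((F.P Kt).d : ℝ) - 1 := by linarith
    positivity
  intro ext Vk R 𝓐₀ hR h𝓐₀ δc δin hδc0 hδin0 hδpos hδρ U₀ Xf hmin0 hC1 hCin hX₀ hXc hmin hKb hsupp
  let δ : ℝ := max δc δin
  have hδ0 : 0 ≤ δ := hδpos.le
  have hδD : δ < ρD := by
    have : δ ≤ ρD / 2 := hδρ.trans ((min_le_left _ _).trans (min_le_left _ _))
    linarith
  have hδg : δ ≤ ρg := hδρ.trans ((min_le_left _ _).trans (min_le_right _ _))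
  have hδμ : δ ≤ ρμ := hδρ.trans ((min_le_right _ _).trans ((min_le_left _ _).trans (min_le_left _ _)))
  have hδb : δ ≤ ρb := hδρ.trans ((min_le_right _ _).trans ((min_le_left _ _).trans (min_le_right _ _)))
  have hδτ : δ < ρτ := by
    have : δ ≤ ρτ / 2 := hδρ.trans ((min_le_right _ _).trans ((min_le_right _ _).trans (min_le_left _ _)))
    linarith
  have hδN : δ ≤ 1 / (2 * (C * ρf + 1)) := hδρ.trans ((min_le_right _ _).trans ((min_le_right _ _).trans (min_le_right _ _)))
  have hUb : ∀ b : PBond (F.P Kt) 0, ‖((U₀ b : SU2) : Matrix (Fin 2) (Fin 2) ℂ) - 1‖ ≤ δ :=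
    norm_sub_one_le_of_plaqNear_of_inputs (F := F) h2 hk0 ν.M₁ Z hC1 hCin
  have hU' : ‖coeField U₀ - 1‖ ≤ δ := norm_coeField_sub_one_le hδ0 hUb
  have h𝔹 : ∀ j', k < j' → Bj ν.M₁ Z k j' = ∅ := fun _ hj' => Bj_of_gt hj'
  have hUfib : AgreeOn (Bj ν.M₁ Z k) (avgFamily (avOfRecord F 2 Kt) U₀) (avgFamily (avOfRecord F 2 Kt) (qsstarGIter0 k (ext Vk))) := hmin0.2.1
  have hsb : SmallBelow (avOfRecord F 2 Kt) k U₀ := hsbU U₀ (hU'.trans hδb)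
  have hcrit : IsCritOnFibre F 2 Kt (Bj ν.M₁ Z k) (avgFamily (avOfRecord F 2 Kt) (qsstarGIter0 k (ext Vk))) U₀ :=
    isCritOnFibre_of_isMinimizer_regMSCoPOfRecord ν (maxDomT ν.M₁ Z) hmin0
  have hgd : ∀ i, i < k → PlaqSmall t₀ (Averaging.iter (avOfRecord F 2 Kt) i U₀) := fun i hi => hguard U₀ (hU'.trans hδg) i hi.le
  have hδ₂w : ∀ w, ‖fderiv ℝ (msChart F 2 Kt k (Bj ν.M₁ Z k) (avgFamily (avOfRecord F 2 Kt) (qsstarGIter0 k (ext Vk))) U₀) 0 w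
      - fderiv ℝ (msChart F 2 Kt k (Bj ν.M₁ Z k) (avgFamily (avOfRecord F 2 Kt) (1 : GaugeField (F.P Kt) 0 SU2)) (1 : GaugeField (F.P Kt) 0 SU2)) 0 w‖ ≤ C * δ * p w := by
    intro w
    refine (hD ht₀ hst U₀ (avgFamily (avOfRecord F 2 Kt) (qsstarGIter0 k (ext Vk))) hgd (lt_of_le_of_lt hU' hδD) hUfib w).trans ?_
    exact mul_le_mul_of_nonneg_right (mul_le_mul_of_nonneg_left hU' hC) (apply_nonneg p w)
  have hδ₂0 : 0 ≤ C * δ := by positivity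
  have hhalf : C * δ * ρf ≤ 1 / 2 := by
    have hpos : 0 < 2 * (C * ρf + 1) := by positivity
    have h1 : δ * (2 * (C * ρf + 1)) ≤ 1 := by
      calc δ * (2 * (C * ρf + 1)) ≤ 1 / (2 * (C * ρf + 1)) * (2 * (C * ρf + 1)) := mul_le_mul_of_nonneg_right hδN hpos.le
        _ = 1 := by field_simp
    have e : C * δ * ρf = (δ * (2 * (C * ρf + 1)) - 2 * δ) / 2 := by ring
    rw [e]
    linarith
  have hsmall : C * δ * ρf < 1 := by linarith
  obtain ⟨Rn, hRn, hρRn⟩ := exists_rightInverse_fun_of_flat_of_delta2 p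
    ((fderiv ℝ (msChart F 2 Kt k (Bj ν.M₁ Z k) (avgFamily (avOfRecord F 2 Kt) (qsstarGIter0 k (ext Vk))) U₀) 0).toLinearMap)
    ((fderiv ℝ (msChart F 2 Kt k (Bj ν.M₁ Z k) (avgFamily (avOfRecord F 2 Kt) (1 : GaugeField (F.P Kt) 0 SU2)) (1 : GaugeField (F.P Kt) 0 SU2)) 0).toLinearMap)
    Hf hHf hρf0 hδ₂0 hρf (fun w => hδ₂w w) hsmall
  have hρR2 : ∀ v, p (Rn v) ≤ 2 * ρf * ‖v‖ := fun v => by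
    refine (hρRn v).trans (mul_le_mul_of_nonneg_right ?_ (norm_nonneg v))
    have h1 : 0 < 1 - C * δ * ρf := by linarith
    rw [div_le_iff₀ h1]
    have h2 : 0 ≤ ρf * (1 - 2 * (C * δ * ρf)) := mul_nonneg hρf0 (by linarith)
    calc ρf = 2 * ρf * (1 - C * δ * ρf) - ρf * (1 - 2 * (C * δ * ρf)) := by ring
      _ ≤ 2 * ρf * (1 - C * δ * ρf) := sub_le_self _ h2
  have hj : ∀ x, |fderiv ℝ (fun Y : PBond (F.P Kt) 0 → lieSU (Fin 2) => wilsonAction4 (expChart U₀ Y)) 0 x| ≤ (8 * (((F.P Kt).d : ℝ) - 1) * δ * n) * p x := by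
    intro x
    have h := letter_j_wilson_local U₀ (Set.univ : Set (PBond (F.P Kt) 0)) hδ0
      (fun q _ => ⟨hUb _, hUb _, hUb _, hUb _⟩) p₁ hp₁ x (fun b hb => absurd (Set.mem_univ b) hb)
    rw [hp₁_apply x] at h
    linarith
  have hd1 : 0 ≤ ((F.P Kt).d : ℝ) - 1 := by
    have : (1 : ℝ) ≤ ((F.P Kt).d : ℝ) := by exact_mod_cast h0
    linarith
  have hj0 : 0 ≤ 8 * (((F.P Kt).d : ℝ) - 1) * δ * n := by positivity
  obtain ⟨lam, hlam, hμw⟩ := hμ (Bj ν.M₁ Z k) (avgFamily (avOfRecord F 2 Kt) (qsstarGIter0 k (ext Vk))) U₀ h𝔹 (hU'.trans hδμ) hUfib hcrit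
    Rn (fun v => hRn v) (8 * (((F.P Kt).d : ℝ) - 1) * δ * n) (2 * ρf) hj0 (by positivity) hj hρR2
  have hΨ₂ := hasFDerivAt_fderiv_msChart hUfib hsb
  have hΨd := eventually_differentiableAt_msChart hUfib hsb
  have hΨ : DifferentiableAt ℝ (msChart F 2 Kt k (Bj ν.M₁ Z k) (avgFamily (avOfRecord F 2 Kt) (qsstarGIter0 k (ext Vk))) U₀) 0 :=
    differentiableAt_msChart hUfib hsb
  have hiter : ‖(iterM k : (PBond (F.P Kt) 0 → Matrix (Fin 2) (Fin 2) ℂ) → PBond (F.P Kt) k → Matrix (Fin 2) (Fin 2) ℂ) (coeField U₀) - 1‖ ≤ Kτ * δ :=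
    (hτW U₀ (lt_of_le_of_lt hU' hδτ)).trans (mul_le_mul_of_nonneg_left hU' hKτ)
  have hcoe : coeField (Averaging.iter (avOfRecord F 2 Kt) k U₀) = iterM k (coeField U₀) := coeField_iter_eq_iterM k hsb
  have hW : ∀ c ∈ bondsOf (Bj ν.M₁ Z k k),
      ‖((avgFamily (avOfRecord F 2 Kt) (qsstarGIter0 k (ext Vk)) k c : SU 2) : Matrix (Fin 2) (Fin 2) ℂ) - 1‖ ≤ (2 * (Kτ + 1) * δ) / 2 := by
    intro c hc
    rw [← hUfib k c hc]
    have e : ((avgFamily (avOfRecord F 2 Kt) U₀ k c : SU 2) : Matrix (Fin 2) (Fin 2) ℂ) - 1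
        = ((iterM k : (PBond (F.P Kt) 0 → Matrix (Fin 2) (Fin 2) ℂ) → PBond (F.P Kt) k → Matrix (Fin 2) (Fin 2) ℂ) (coeField U₀) - 1) c := by
      rw [Pi.sub_apply, ← hcoe, coeField_apply, Pi.one_apply]; rfl
    rw [e]
    refine (norm_le_pi_norm _ c).trans (hiter.trans ?_)
    nlinarith
  have hτ : 0 < 2 * (Kτ + 1) * δ := by positivity
  have hX1 := (hXc.differentiableAt two_ne_zero).hasFDerivAt
  have hN2 : ((2 : ℕ) : ℝ) = 2 := Nat.cast_ofNat
  refine ⟨fderiv ℝ (fderiv ℝ (msChart F 2 Kt k (Bj ν.M₁ Z k) (avgFamily (avOfRecord F 2 Kt) (qsstarGIter0 k (ext Vk))) U₀)) 0, lam, p,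
    fderiv ℝ (msChart F 2 Kt k (Bj ν.M₁ Z k) (avgFamily (avOfRecord F 2 Kt) (1 : GaugeField (F.P Kt) 0 SU2)) (1 : GaugeField (F.P Kt) 0 SU2)) 0,
    fun v => Hf v, hΨ₂, hΨd, hlam, hp, hHf, hρf, fun X => ⟨hδ₂w _, ?_, ?_, ?_⟩⟩
  · -- (μ)
    have h := hμw (fderiv ℝ Xf 0 X)
    rw [hN2] at h
    refine h.trans (le_of_eq ?_)
    ring
  · -- (K) from the per-bond velocity bound and the support letter
    have ha : 0 ≤ 12 * 𝓐₀ / R * ‖X‖ := by positivity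
    have h := l2Seminorm_le_of_bound_of_support (N := 2) (maxDomT ν.M₁ Z 1) (fderiv ℝ Xf 0 X) ha (fun b => (hKb X b).2) (fun b hb => hsupp X b hb)
    calc p (fderiv ℝ Xf 0 X) ≤ Real.sqrt (Nat.card {b : PBond (F.P Kt) 0 // b.src ∈ maxDomT ν.M₁ Z 1}) * (12 * 𝓐₀ / R * ‖X‖) := h
      _ = (12 * 𝓐₀ / R * Real.sqrt (Nat.card {b : PBond (F.P Kt) 0 // b.src ∈ maxDomT ν.M₁ Z 1})) * ‖X‖ := by ring
  · -- the Federbush clause at the curved chart, through the twist (Pauli coordinates of `𝔰𝔲(2)` by dag-n12-w3's `exists_lieSU2Coord`, eliminated in term mode: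
    -- an `obtain` on it makes later elaboration of `GaugeSlice … E3`-typed terms time out at `whnf` in this context)
    exact exists_lieSU2Coord.elim fun φ hφ =>
      exists_m_hm_twisted_window_of_isMinimizer_family h0 hk Z X (fun κ => lo κ - 2) hbox hφ hΩw
        (regMSCoPOfRecord F 2 ν Kt k (maxDomT ν.M₁ Z)) (ext Vk) U₀ hX₀ hmin hX1 hΨ hτ hW


/-! ## §2  ★★★ The letter `(χ)_η`: print's η-units for `q` -/

set_option maxHeartbeats 400000 in
/-- ★★★ **THE CHART LETTER `(χ)_η` OF p629636 §4, VERBATIM** — `chartLetter_of_letters_supNorm` with the right-inverse row re-read through `‖v‖ ≤ q_η(v)` (§0) and the (δ₂) row through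
dag-n10-w1's `qEta_le_sqrt_sum_mul_norm` ((iii) §1); constants as in file 2 with `C₂ ↦ C₂·√(Σ_i levelWeight j_i)` (per instance).  See the module docstring for what is and is not claimed about
`ρc` in these units. [cite: Balaban1989LargeFieldII, p.357, (1.12)–(1.13) p.359, (17)–(19) pp.360–361; Balaban1985Variational, Sect. C (44)–(48) p.285, (81)–(83) p.290; Balaban1988Convergent, (2.2) p.255, (2.10)–(2.13) pp.256–257] -/
theorem chartLetter_of_letters_eta (ν : Node00.Stage7Numerics) (Kt : ℕ) (h0 : 0 < (F.P Kt).d) (h2 : 2 ≤ (F.P Kt).d)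
    {k : ℕ} (hk0 : 0 < k) (hk : k ≤ (F.P Kt).m + (F.P Kt).K)
    (Z Λ : Set (Site (F.P Kt) 0)) (T : Finset (PBond (F.P Kt) k)) (lo hi : Fin (F.P Kt).d → ℤ)
    -- instance geometry letters (displayed)
    (hM2 : 2 ≤ ν.M₁) (hdiv : side (F.P Kt).L ν.M₁ k ∣ (F.P Kt).sitesPerDir 0)
    (hbox : ∀ κ, (((hi κ - lo κ + 1).toNat + 3 : ℕ) : ℤ) ≤ (F.P Kt).sitesPerDir k)
    (hΩw : ∀ (ν' : Fin (F.P Kt).d), ∀ z ∈ box (fun κ => (hi κ - lo κ + 1).toNat + 3) (fun κ => lo κ - 2),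
      (castSite z : Site (F.P Kt) k) ∈ pts k (maxDomT ν.M₁ Z k) ∧ (castSite z : Site (F.P Kt) k).shift ⟨0, h0⟩ ∈ pts k (maxDomT ν.M₁ Z k) ∧
        (castSite z : Site (F.P Kt) k).shift ν' ∈ pts k (maxDomT ν.M₁ Z k)) :
    ∃ ρs Cμ Cρ C₂ Cτ : ℝ, 0 < ρs ∧ 0 ≤ Cμ ∧ 0 ≤ Cρ ∧ 0 ≤ C₂ ∧ 0 ≤ Cτ ∧
      ∀ (ext : GaugeField (F.P Kt) k SU2 → GaugeField (F.P Kt) k SU2) (Vk : GaugeField (F.P Kt) k SU2) {R 𝓐₀ : ℝ}, 0 < R → 0 ≤ 𝓐₀ →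
      ∀ {δc δin : ℝ}, 0 ≤ δc → 0 ≤ δin → 0 < max δc δin → max δc δin ≤ ρs →
      ∀ (U₀ : GaugeField (F.P Kt) 0 SU2) (Xf : GaugeSlice (pts k Λ) T E3 → PBond (F.P Kt) 0 → lieSU (Fin 2)),
      IsMinimizer (Node00.avOfRecord F 2 Kt) (Node00.regMSCoPOfRecord F 2 ν Kt k (maxDomT ν.M₁ Z)) (Bj ν.M₁ Z k)
        (avgFamily (Node00.avOfRecord F 2 Kt) (qsstarGIter0 k (ext Vk))) U₀ →
      (∀ p : Plaq (F.P Kt) 0, ((⟨p.src, p.μ⟩ : PBond (F.P Kt) 0) ∈ {b : PBond (F.P Kt) 0 | b.src ∈ maxDomT ν.M₁ Z 1} ∨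
          (⟨p.src.shift p.μ, p.ν⟩ : PBond (F.P Kt) 0) ∈ {b : PBond (F.P Kt) 0 | b.src ∈ maxDomT ν.M₁ Z 1} ∨
          (⟨p.src.shift p.ν, p.μ⟩ : PBond (F.P Kt) 0) ∈ {b : PBond (F.P Kt) 0 | b.src ∈ maxDomT ν.M₁ Z 1} ∨
          (⟨p.src, p.ν⟩ : PBond (F.P Kt) 0) ∈ {b : PBond (F.P Kt) 0 | b.src ∈ maxDomT ν.M₁ Z 1}) →
        ‖((U₀ ⟨p.src, p.μ⟩ : SU2) : Matrix (Fin 2) (Fin 2) ℂ) - 1‖ ≤ δc ∧ ‖((U₀ ⟨p.src.shift p.μ, p.ν⟩ : SU2) : Matrix (Fin 2) (Fin 2) ℂ) - 1‖ ≤ δc ∧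
          ‖((U₀ ⟨p.src.shift p.ν, p.μ⟩ : SU2) : Matrix (Fin 2) (Fin 2) ℂ) - 1‖ ≤ δc ∧ ‖((U₀ ⟨p.src, p.ν⟩ : SU2) : Matrix (Fin 2) (Fin 2) ℂ) - 1‖ ≤ δc) →
      (∀ b ∈ inputs (Bj ν.M₁ Z k), ‖((U₀ b : SU2) : Matrix (Fin 2) (Fin 2) ℂ) - 1‖ ≤ δin) →
      Xf 0 = 0 → ContDiffAt ℝ 2 Xf 0 →
      (∀ᶠ Y in 𝓝 (0 : GaugeSlice (pts k Λ) T E3),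
        IsMinimizer (Node00.avOfRecord F 2 Kt) (Node00.regMSCoPOfRecord F 2 ν Kt k (maxDomT ν.M₁ Z)) (Bj ν.M₁ Z k)
          (avgFamily (Node00.avOfRecord F 2 Kt) (qsstarGIter0 k (expMul su2Chart (ιA (pts k Λ) T Y) (ext Vk)))) (expChart U₀ (Xf Y))) →
      (∀ (X : GaugeSlice (pts k Λ) T E3) (b : PBond (F.P Kt) 0),
        ‖((fderiv ℝ Xf 0 X b : lieSU (Fin 2)) : Matrix (Fin 2) (Fin 2) ℂ)‖ ≤ 8 * 𝓐₀ / R * ‖X‖ ∧ ‖fderiv ℝ Xf 0 X b‖ ≤ 12 * 𝓐₀ / R * ‖X‖) →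
      (∀ (X : GaugeSlice (pts k Λ) T E3) (b : PBond (F.P Kt) 0), b.src ∉ maxDomT ν.M₁ Z 1 → fderiv ℝ Xf 0 X b = 0) →
      ∃ (Ψ₂ : (PBond (F.P Kt) 0 → lieSU (Fin 2)) →L[ℝ] (PBond (F.P Kt) 0 → lieSU (Fin 2)) →L[ℝ] (Fin (constrCard (Bj ν.M₁ Z k) k) → lieSU (Fin 2)))
        (lam : (Fin (constrCard (Bj ν.M₁ Z k) k) → lieSU (Fin 2)) →L[ℝ] ℝ)
        (p : Seminorm ℝ (PBond (F.P Kt) 0 → lieSU (Fin 2)))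
        (Lf : (PBond (F.P Kt) 0 → lieSU (Fin 2)) →L[ℝ] (Fin (constrCard (Bj ν.M₁ Z k) k) → lieSU (Fin 2)))
        (Rf : (Fin (constrCard (Bj ν.M₁ Z k) k) → lieSU (Fin 2)) → PBond (F.P Kt) 0 → lieSU (Fin 2)),
        HasFDerivAt (fun Y => fderiv ℝ (msChart F 2 Kt k (Bj ν.M₁ Z k) (avgFamily (Node00.avOfRecord F 2 Kt) (qsstarGIter0 k (ext Vk))) U₀) Y) Ψ₂ 0 ∧
        (∀ᶠ Y in 𝓝 (0 : PBond (F.P Kt) 0 → lieSU (Fin 2)),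
          DifferentiableAt ℝ (msChart F 2 Kt k (Bj ν.M₁ Z k) (avgFamily (Node00.avOfRecord F 2 Kt) (qsstarGIter0 k (ext Vk))) U₀) Y) ∧
        fderiv ℝ (fun Y : PBond (F.P Kt) 0 → lieSU (Fin 2) => wilsonAction4 (expChart U₀ Y)) 0 =
          lam.comp (fderiv ℝ (msChart F 2 Kt k (Bj ν.M₁ Z k) (avgFamily (Node00.avOfRecord F 2 Kt) (qsstarGIter0 k (ext Vk))) U₀) 0) ∧
        (∀ Y : PBond (F.P Kt) 0 → lieSU (Fin 2), ∑ b, ‖(Y b : Matrix (Fin 2) (Fin 2) ℂ)‖ ^ 2 ≤ p Y ^ 2) ∧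
        (∀ v, Lf (Rf v) = v) ∧ (∀ v, p (Rf v) ≤ Cρ * Real.sqrt (∑ i, ((((F.P Kt).L : ℝ) ^ (F.P Kt).d) / (((F.P Kt).L : ℝ) ^ 2)) ^ (((Node00.constrEnum (Bj ν.M₁ Z k : DetSet (F.P Kt)) k).symm i).1 : ℕ) * ‖(v) i‖ ^ 2)) ∧
        ∀ X : GaugeSlice (pts k Λ) T E3,
          Real.sqrt (∑ i, ((((F.P Kt).L : ℝ) ^ (F.P Kt).d) / (((F.P Kt).L : ℝ) ^ 2)) ^ (((Node00.constrEnum (Bj ν.M₁ Z k : DetSet (F.P Kt)) k).symm i).1 : ℕ) * ‖(fderiv ℝ (msChart F 2 Kt k (Bj ν.M₁ Z k) (avgFamily (Node00.avOfRecord F 2 Kt) (qsstarGIter0 k (ext Vk))) U₀) 0 (fderiv ℝ Xf 0 X) - Lf (fderiv ℝ Xf 0 X)) i‖ ^ 2)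
            ≤ (C₂ * max δc δin) * p (fderiv ℝ Xf 0 X) ∧
          lam (Ψ₂ (fderiv ℝ Xf 0 X) (fderiv ℝ Xf 0 X)) ≤ (Cμ * max δc δin) * p (fderiv ℝ Xf 0 X) ^ 2 ∧
          p (fderiv ℝ Xf 0 X) ≤ (12 * 𝓐₀ / R * Real.sqrt (Nat.card {b : PBond (F.P Kt) 0 // b.src ∈ maxDomT ν.M₁ Z 1})) * ‖X‖ ∧
          ∃ m : ℝ, (∀ w', Lf w' = fderiv ℝ (msChart F 2 Kt k (Bj ν.M₁ Z k) (avgFamily (Node00.avOfRecord F 2 Kt) (qsstarGIter0 k (ext Vk))) U₀) 0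
                (fderiv ℝ Xf 0 X) →
              m ≤ fderiv ℝ (fun Y => fderiv ℝ (fun Y : PBond (F.P Kt) 0 → lieSU (Fin 2) => wilsonAction4 (expChart (1 : GaugeField (F.P Kt) 0 SU2) Y)) Y) 0 w' w') ∧
            (((F.P Kt).L : ℝ) ^ (F.P Kt).d) ^ k / ((((F.P Kt).L : ℝ)) ^ 2 * ((F.P Kt).L : ℝ) ^ 2) ^ k *
                (∑ z ∈ box (fun κ => (hi κ - lo κ + 1).toNat + 3) (fun κ => lo κ - 2), ∑ μ : Fin (F.P Kt).d, ∑ a : Fin 3,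
                  curl (fun b => ιA (pts k Λ) T X (⟨castSite b.1, b.2⟩ : PBond (F.P Kt) k) a) z ⟨0, h0⟩ μ ^ 2)
              - ((((F.P Kt).L : ℝ) ^ (F.P Kt).d) ^ k / ((((F.P Kt).L : ℝ)) ^ 2 * ((F.P Kt).L : ℝ) ^ 2) ^ k
                  * (16 * (((F.P Kt).d : ℝ) + 1) * (Cτ * max δc δin))) * ‖X‖ ^ 2 ≤ m  := by
  obtain ⟨ρs, Cμ, Cρ, C₂, Cτ, hρs, hCμ, hCρ, hC₂, hCτ, H⟩ := chartLetter_of_letters_supNorm ν Kt h0 h2 hk0 hk Z Λ T lo hi hM2 hdiv hbox hΩw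
  -- the total row weight of print's η-units on `𝐁_k(Z)` (dag-n10-w1's `levelWeight`)
  let Sw : ℝ := Real.sqrt (∑ i : Fin (constrCard (Bj ν.M₁ Z k) k), levelWeight (F.P Kt) (((constrEnum (Bj ν.M₁ Z k) k).symm i).1 : ℕ))
  have hSw : 0 ≤ Sw := Real.sqrt_nonneg _
  refine ⟨ρs, Cμ, Cρ, C₂ * Sw, Cτ, hρs, hCμ, hCρ, mul_nonneg hC₂ hSw, hCτ, ?_⟩
  intro ext Vk R 𝓐₀ hR h𝓐₀ δc δin hδc0 hδin0 hδpos hδρ U₀ Xf hmin0 hC1 hCin hX₀ hXc hmin hKb hsupp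
  obtain ⟨Ψ₂, lam, p, Lf, Rf, hΨ₂, hΨd, hlam, hp, hRf, hρ, htail⟩ :=
    H ext Vk hR h𝓐₀ hδc0 hδin0 hδpos hδρ U₀ Xf hmin0 hC1 hCin hX₀ hXc hmin hKb hsupp
  refine ⟨Ψ₂, lam, p, Lf, Rf, hΨ₂, hΨd, hlam, hp, hRf, fun v => ?_, fun X => ?_⟩
  · -- `p (R_f v) ≤ ρc·‖v‖ ≤ ρc·q_η(v)` (every level weight is `≥ 1` at `d ≥ 2`)
    have h1 : ‖v‖ ≤ qEta (Bj ν.M₁ Z k : DetSet (F.P Kt)) k v := norm_le_qEta h2 (Bj ν.M₁ Z k) k v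
    calc p (Rf v) ≤ Cρ * ‖v‖ := hρ v
      _ ≤ Cρ * qEta (Bj ν.M₁ Z k : DetSet (F.P Kt)) k v := mul_le_mul_of_nonneg_left h1 hCρ
      _ = _ := by rw [qEta_def]
  · obtain ⟨hδ₂, hμ, hK, hm⟩ := htail X
    refine ⟨?_, hμ, hK, hm⟩
    -- `q_η(defect) ≤ √(Σ_i levelWeight j_i)·‖defect‖` (dag-n10-w1's (iii) §1, by name) `≤ √(Σ…)·(C₂·max δc δin)·p`
    have h1 := qEta_le_sqrt_sum_mul_norm (Bj ν.M₁ Z k : DetSet (F.P Kt)) k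
      (fderiv ℝ (msChart F 2 Kt k (Bj ν.M₁ Z k) (avgFamily (Node00.avOfRecord F 2 Kt) (qsstarGIter0 k (ext Vk))) U₀) 0 (fderiv ℝ Xf 0 X) - Lf (fderiv ℝ Xf 0 X))
    rw [qEta_def] at h1
    refine h1.trans ?_
    calc Sw * ‖fderiv ℝ (msChart F 2 Kt k (Bj ν.M₁ Z k) (avgFamily (Node00.avOfRecord F 2 Kt) (qsstarGIter0 k (ext Vk))) U₀) 0 (fderiv ℝ Xf 0 X) - Lf (fderiv ℝ Xf 0 X)‖
        ≤ Sw * ((C₂ * max δc δin) * p (fderiv ℝ Xf 0 X)) := mul_le_mul_of_nonneg_left hδ₂ hSw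
      _ = (C₂ * Sw * max δc δin) * p (fderiv ℝ Xf 0 X) := by ring

end Main

end Summit.QuantumFields.YangMills.BalabanUVNodes.N12NearFlatChartLetter

end
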